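import Summits.BirchSwinnertonDyer.BirchSwinnertonDyer.Theorems.ByReductionTypeAtTwoSupersingularSharpTwo
import Summits.BirchSwinnertonDyer.Rank1Residual.Supersingular.MazurTateHeckeDescent
import HarnessLib

/-!
# Route `ByReductionTypeAtTwo` (rung K4), crux `SupersingularRankZeroAtTwo` (item
# stmt-BirchSwinnertonDyer-19097): NO POLLACK PAIR OFF `a_p = 0` — the typed obstruction of the
# `a₂ = ±2` sub-row as a KERNEL THEOREM (seat `bsd-2adic-ss-1`, GEN 3)

HONEST FRAMING (cell `bsd-2adic`, run/shared/lean/pub/bsd-2adic/, HUMAN RULINGS D-0036/D-0059/D-0074):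
THEOREMS ONLY; no definition, no named fact, no `sorry`; nothing about any Selmer group is asserted;
nothing is booked. PARTITION (D-0054): X5@2 good-ss (B1·O1; 757 r0 book230 classes, `a₂ = 0 : +2 : −2 =
208 : 483 : 66`) × p = 2 — types-the-object-of (the TYPED OBSTRUCTION on the `a₂ = ±2` sub-row, 549
classes); closes none. bears_on: K4 (route-BirchSwinnertonDyer-ByReductionTypeAtTwo item 19097).

## What is proved, and why

The route text of the crux names as "layer-2 objects typed" the X-kernel's signed leaves
`SS.KobayashiMainConjecture W 2 ε` / `SS.KobayashiLowerDivisibility W 2 ε`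
(`Supersingular/KobayashiMainConjecture.lean`), which quantify over **Pollack pairs**
`IsPollackPair f 2 L⁺ L⁻` — the Mazur–Tate congruences `θ_n ≡ ±ω_n^± L^± (mod ω_n)` of Pollack 2003,
Prop. 6.18, with `L⁺ ≠ 0 ≠ L⁻`. GEN 0 of this seat showed that at `a₂ = 0` such a pair EXISTS at `2`
(`exists_isPollackPair_two`, from Sprung's pair), so the leaves have content there; the line card of
`signed-halves-two` records for `a₂ = ±2` only the PROSE placement "Kobayashi's `±` objects are the
wrong ones off `a_p = 0`" (Sprung, JNT 132 (2012) p. 1485). This file makes that placement a theorem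
of the tree, for every prime:

* `not_isPollackPair_of_cuspCoeff_ne_zero` — **a rational newform `f` of level `N`, `p ∤ N`, with
  `a_p(f) ≠ 0` admits NO Pollack pair at `p`.** Proof (all inputs are tree theorems): the congruence
  at level `e + 1` kills `θ_{e+1}` at every `ζ − 1` with `ζ` of exact order `p^e`, `e ≥ 1` (the
  parity of `e` is opposite to that of `e + 1`, so `ζ − 1` is a root of `ω_{e+1}^∓`;
  `IsCongrModOmega.eval₂_eq`); the tree's evaluated three-term relation
  (`eval₂_mazurTateElement_threeTerm`, Mazur–Tate–Teitelbaum (10.2) / Sprung's queue relation, ANY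
  `p`) reads there `θ_{e+1}(ζ − 1) = a_p · θ_e(ζ − 1)` (`Φ_{p^e}(ζ) = 0`), so `a_p ≠ 0` forces
  `θ_e(ζ − 1) = 0`; the congruence at level `e` (same parity, `ω_e^±(ζ − 1) ≠ 0`, Pollack Lemma 4.7 =
  `eval₂_cyclotomicOmegaPlus_ne_zero`) then makes every `ζ − 1` with `ζ` of exact order `p^e`, `e`
  odd, a zero of `L⁺` in the open unit disc — infinitely many, against the finiteness of the zero
  set of a non-zero Iwasawa function (`MemIwasawaRat.finite_setOf_hasSum_zero`). No `L`-value
  non-vanishing (Rohrlich) is used.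
* `kobayashiMainConjecture_of_frobeniusTrace_ne_zero`, `kobayashiLowerDivisibility_of_frobeniusTrace_ne_zero`
  — for `W` with good reduction at `p` and `a_p(W) ≠ 0` the X-kernel's `KobayashiMainConjecture W p ε`
  and `KobayashiLowerDivisibility W p ε` HOLD VACUOUSLY (their Pollack-pair binder is empty): on such
  classes these `@[conjecture]` leaves carry no content and can feed no door.
* `p = 2` readings for the crux: `exists_isPollackPair_two_iff_frobeniusTrace_eq_zero` (with GEN 0's
  `exists_isPollackPair_two`: in analytic rank `0`, **a Pollack pair at `2` exists iff `a₂ = 0`**);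
  `traceTwo_kobayashiMainConjecture_two` / `traceTwo_kobayashiLowerDivisibility_two` (the ∀-closed
  class-level statements on the `a₂ = ±2` sub-row, PROVED — i.e. vacuous). Consequence for the
  registered line `signed-halves-two`: stub (5) `stub_traceTwoMillerHalves` (`a₂ = ±2`, MATH-BOUND)
  cannot be re-typed through the tree's signed leaves — the kernel form of the MATH-BOUND tag; the
  `a₂ = 0` stubs (2)–(4) are untouched (their Pollack binder is inhabited, `exists_isPollackPair_two`).
* The same theorem applies verbatim at `p = 3`, `a₃ = ±3` (class X8 of the residual programme, which
  is typed through Sprung's `♯/♭` pair `SignedMainConjectureThree`, not through Pollack pairs).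

References: R. Pollack, Duke Math. J. 118 (2003), Lemma 4.7, Prop. 6.18 [Pollack2003]; B. Mazur,
J. Tate, J. Teitelbaum, Invent. Math. 84 (1986) §I.10 (10.2) [MazurTateTeitelbaum1986Invent];
F. Sprung, J. Number Theory 132 (2012) p. 1485 ("`Col♯ = Col⁻`, `Col♭ = Col⁺` only for `a_p = 0`")
[Sprung2012]; S. Kobayashi, Invent. Math. 152 (2003) Conjecture p. 2 ("Suppose `a_p = 0`")
[Kobayashi2003].
-/

set_option autoImplicit false
-- the Theorems namespace of this sub repeats the summit name by design (D-0017 nested layout)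
set_option linter.dupNamespace false

noncomputable section

open scoped Classical MatrixGroups ModularForm

open CongruenceSubgroup Polynomial WeierstrassCurve Literature.NumberTheory.EllipticCurves
  Literature.NumberTheory.EllipticCurves.ModularForms
  Literature.NumberTheory.EllipticCurves.Rank1Residual
  Summit.BirchSwinnertonDyer.Rank1Residual.Supersingular

namespace Summit.BirchSwinnertonDyer.BirchSwinnertonDyer.Theorems

/-! ## §1 Roots of `ω_n^±` -/

section OmegaRoots

variable {p : ℕ} [hp : Fact p.Prime]

/-- `ω_n^+(ζ − 1) = 0` for `ζ ∈ ℂ_p` of order exactly `p^{2i}` with `1 ≤ i`, `2i ≤ n`: the factor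
`Φ_{p^{2i}}(1 + T)` of `ω_n^+` vanishes at `T = ζ − 1`. [cite: Pollack2003, §6.5 (display before Prop. 6.18)] -/
theorem eval₂_cyclotomicOmegaPlus_eq_zero {n i : ℕ} (hi : 1 ≤ i) (hin : 2 * i ≤ n) {ζ : ℂ_[p]}
    (hζ : IsPrimitiveRoot ζ (p ^ (2 * i))) :
    (cyclotomicOmegaPlus p n).eval₂ (algebraMap ℤ ℂ_[p]) (ζ - 1) = 0 := by
  rw [cyclotomicOmegaPlus, eval₂_finsetProd, Finset.prod_eq_zero_iff]
  refine ⟨i, Finset.mem_Icc.mpr ⟨hi, by omega⟩, ?_⟩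
  rw [eval₂_comp, eval₂_add, eval₂_X, eval₂_one, sub_add_cancel, eval₂_eq_eval_map, map_cyclotomic]
  exact ((isRoot_cyclotomic_iff_charZero (pow_pos hp.out.pos _)).mpr hζ).eq_zero

/-- `ω_n^-(ζ − 1) = 0` for `ζ ∈ ℂ_p` of order exactly `p^{2i−1}` with `1 ≤ i`, `2i − 1 ≤ n`: the
factor `Φ_{p^{2i−1}}(1 + T)` of `ω_n^-` vanishes at `T = ζ − 1`. [cite: Pollack2003, §6.5 (display before Prop. 6.18)] -/
theorem eval₂_cyclotomicOmegaMinus_eq_zero {n i : ℕ} (hi : 1 ≤ i) (hin : 2 * i - 1 ≤ n) {ζ : ℂ_[p]}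
    (hζ : IsPrimitiveRoot ζ (p ^ (2 * i - 1))) :
    (cyclotomicOmegaMinus p n).eval₂ (algebraMap ℤ ℂ_[p]) (ζ - 1) = 0 := by
  rw [cyclotomicOmegaMinus, eval₂_finsetProd, Finset.prod_eq_zero_iff]
  refine ⟨i, Finset.mem_Icc.mpr ⟨hi, by omega⟩, ?_⟩
  rw [eval₂_comp, eval₂_add, eval₂_X, eval₂_one, sub_add_cancel, eval₂_eq_eval_map, map_cyclotomic]
  exact ((isRoot_cyclotomic_iff_charZero (pow_pos hp.out.pos _)).mpr hζ).eq_zero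

end OmegaRoots

/-! ## §2 No Pollack pair off `a_p = 0` -/

section NoPollackPair

variable {N : ℕ} [NeZero N] {f : CuspForm (Gamma0 N) 2} {p : ℕ} [hp : Fact p.Prime]

omit [NeZero N] in
/-- **The level-`(e+1)` congruence kills `θ_{e+1}` at the points of order `p^e`.** For a Pollack
pair `(L⁺, L⁻)` of `f` at `p` and `ζ ∈ ℂ_p` of order exactly `p^e`, `e ≥ 1`:
`θ_{e+1}(ζ − 1) = 0` — `ζ − 1` is a root of `ω_{e+1}^-` (`e` odd) resp. `ω_{e+1}^+` (`e` even), and the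
congruence `θ_{e+1} ≡ ±ω_{e+1}^∓ L^∓ (mod ω_{e+1})` is an equality of values at `ζ − 1`
(`IsCongrModOmega.eval₂_eq`). [cite: Pollack2003, Prop. 6.18] -/
theorem eval₂_mazurTateElement_succ_eq_zero_of_isPollackPair {Lplus Lminus : IwasawaAlgebra p}
    (hP : IsPollackPair f p Lplus Lminus) {e : ℕ} (he : 1 ≤ e) {ζ : ℂ_[p]}
    (hζ : IsPrimitiveRoot ζ (p ^ e)) :
    (mazurTateElement f p (e + 1)).eval₂ (algebraMap ℚ ℂ_[p]) (ζ - 1) = 0 := by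
  have hpow : ζ ^ p ^ e = 1 := hζ.pow_eq_one
  have hz : ‖ζ - 1‖ < 1 := norm_sub_one_lt_one_of_pow_prime_pow_eq_one hpow
  have hzn : (1 + (ζ - 1)) ^ p ^ (e + 1) = 1 := by
    rw [add_sub_cancel, pow_succ, pow_mul, hpow, one_pow]
  rcases Nat.even_or_odd e with ⟨i, hi⟩ | ⟨i, hi⟩
  · -- `e = 2i` even, `e + 1` odd: the `+` congruence, `ω_{e+1}^+(ζ − 1) = 0`
    have hodd : Odd (e + 1) := ⟨i, by omega⟩
    have h := (hP.2.2.1 (e + 1) hodd).eval₂_eq hz hzn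
    rw [eval₂_mul, eval₂_pow, eval₂_neg, eval₂_one,
      eval₂_cyclotomicOmegaPlus_eq_zero (i := i) (by omega) (by omega)
        (by rw [show 2 * i = e by omega]; exact hζ)] at h
    rw [h, mul_zero, zero_mul]
  · -- `e = 2i + 1` odd, `e + 1` even: the `−` congruence, `ω_{e+1}^-(ζ − 1) = 0`
    have heven : Even (e + 1) := ⟨i + 1, by omega⟩
    have h := (hP.2.2.2 (e + 1) heven).eval₂_eq hz hzn
    rw [eval₂_mul, eval₂_pow, eval₂_neg, eval₂_one,
      eval₂_cyclotomicOmegaMinus_eq_zero (i := i + 1) (by omega) (by omega)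
        (by rw [show 2 * (i + 1) - 1 = e by omega]; exact hζ)] at h
    rw [h, mul_zero, zero_mul]

/-- **Hecke descent, one step**: for a rational newform `f` of level `N`, `p ∤ N`, `a_p(f) = a_p ≠ 0`,
and `ζ ∈ ℂ_p` of order exactly `p^e`, `e ≥ 1`: if `θ_{e+1}(ζ − 1) = 0` then `θ_e(ζ − 1) = 0` — the
evaluated three-term relation `θ_{e+1}(ζ − 1) = a_p θ_e(ζ − 1) − Φ_{p^e}(ζ) θ_{e−1}(ζ − 1)` with
`Φ_{p^e}(ζ) = 0`. [cite: MazurTateTeitelbaum1986Invent, §I.10 Prop. (10.2)] -/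
theorem eval₂_mazurTateElement_eq_zero_of_succ (hf0 : IsNewform0 f) (hQ : coeffField f = ⊥)
    (hpN : ¬ p ∣ N) {ap : ℤ} (hap : cuspCoeff f p = ap) (hap0 : ap ≠ 0) {e : ℕ} (he : 1 ≤ e)
    {ζ : ℂ_[p]} (hζ : IsPrimitiveRoot ζ (p ^ e))
    (h0 : (mazurTateElement f p (e + 1)).eval₂ (algebraMap ℚ ℂ_[p]) (ζ - 1) = 0) :
    (mazurTateElement f p e).eval₂ (algebraMap ℚ ℂ_[p]) (ζ - 1) = 0 := by
  obtain ⟨m, rfl⟩ : ∃ m, e = m + 1 := ⟨e - 1, by omega⟩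
  have h := eval₂_mazurTateElement_threeTerm hf0 hQ hpN hap m hζ.pow_eq_one
  rw [eval_cyclotomic_prime_pow_succ_of_isPrimitiveRoot hζ, zero_mul, sub_zero,
    show m + 2 = m + 1 + 1 by ring, h0] at h
  have hap' : (ap : ℂ_[p]) ≠ 0 := Int.cast_ne_zero.mpr hap0
  exact (mul_eq_zero.mp h.symm).resolve_left hap'

/-- **Every point of odd exact order is a zero of `L⁺`.** For a rational newform `f` of level `N`,
`p ∤ N`, `a_p(f) ≠ 0`, a Pollack pair `(L⁺, L⁻)` at `p`, and `ζ ∈ ℂ_p` of order exactly `p^e` with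
`e` odd: `L⁺(ζ − 1) = ∑_k l_k (ζ − 1)^k = 0` — from `θ_e(ζ − 1) = 0` (the two previous theorems) and
the level-`e` congruence `θ_e(ζ − 1) = ±ω_e^+(ζ − 1) · L⁺(ζ − 1)` with `ω_e^+(ζ − 1) ≠ 0`
(Pollack, Lemma 4.7). [cite: Pollack2003, Lemma 4.7 and Prop. 6.18] -/
theorem hasSum_pollackPlus_zero_of_cuspCoeff_ne_zero (hf0 : IsNewform0 f) (hQ : coeffField f = ⊥)
    (hpN : ¬ p ∣ N) {ap : ℤ} (hap : cuspCoeff f p = ap) (hap0 : ap ≠ 0)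
    {Lplus Lminus : IwasawaAlgebra p} (hP : IsPollackPair f p Lplus Lminus) {e : ℕ} (he : Odd e)
    {ζ : ℂ_[p]} (hζ : IsPrimitiveRoot ζ (p ^ e)) :
    HasSum (fun k ↦ ((algebraMap ℚ_[p] ℂ_[p]).comp (algebraMap ℤ_[p] ℚ_[p]))
        (PowerSeries.coeff k Lplus) * (ζ - 1) ^ k) 0 := by
  have he1 : 1 ≤ e := by obtain ⟨i, rfl⟩ := he; omega
  have hpow : ζ ^ p ^ e = 1 := hζ.pow_eq_one
  have hz : ‖ζ - 1‖ < 1 := norm_sub_one_lt_one_of_pow_prime_pow_eq_one hpow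
  have hzn : (1 + (ζ - 1)) ^ p ^ e = 1 := by rw [add_sub_cancel, hpow]
  -- `θ_e(ζ − 1) = 0`
  have hθ : (mazurTateElement f p e).eval₂ (algebraMap ℚ ℂ_[p]) (ζ - 1) = 0 :=
    eval₂_mazurTateElement_eq_zero_of_succ hf0 hQ hpN hap hap0 he1 hζ
      (eval₂_mazurTateElement_succ_eq_zero_of_isPollackPair hP he1 hζ)
  -- the level-`e` congruence evaluated at `ζ − 1`
  have h := (hP.2.2.1 e he).eval₂_eq hz hzn
  rw [hθ, eval₂_mul, eval₂_pow, eval₂_neg, eval₂_one] at h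
  have hω : (cyclotomicOmegaPlus p e).eval₂ (algebraMap ℤ ℂ_[p]) (ζ - 1) ≠ 0 :=
    eval₂_cyclotomicOmegaPlus_ne_zero he hζ
  have hsign : ((-1 : ℂ_[p]) ^ (e / 2 + 1)) ≠ 0 := pow_ne_zero _ (neg_ne_zero.mpr one_ne_zero)
  have htsum : ∑' k, ((algebraMap ℚ_[p] ℂ_[p]).comp (algebraMap ℤ_[p] ℚ_[p]))
      (PowerSeries.coeff k Lplus) * (ζ - 1) ^ k = 0 := by
    rw [eq_comm, mul_eq_zero, mul_eq_zero, or_iff_right hsign, or_iff_right hω] at h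
    exact h
  have hs := (summable_map_coeff_mul_pow _ (norm_algebraMap_coeff_le_one Lplus) hz).hasSum
  rwa [htsum] at hs

/-- **NO POLLACK PAIR OFF `a_p = 0`.** A rational newform `f ∈ S₂(Γ₀(N))` (`IsNewform0 f`,
`coeffField f = ⊥`) with `p ∤ N` and `a_p(f) ≠ 0` admits no Pollack pair `(L⁺, L⁻)` at `p`
(`IsPollackPair f p L⁺ L⁻`: both non-zero and satisfying the Mazur–Tate congruences of Pollack's
Prop. 6.18 at every level). Proof: by the previous theorem every `ζ − 1` with `ζ ∈ ℂ_p` of exact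
order `p^e`, `e` odd, is a zero of `L⁺` in the open unit disc; these are infinitely many
(`e ↦ p^e = ord(ζ)` recovers `e`), whereas a non-zero element of `Λ` has finitely many such zeros
(`MemIwasawaRat.finite_setOf_hasSum_zero`). So Pollack's `a_p = 0` hypothesis (and Kobayashi's,
Conjecture p. 2: "Suppose `a_p = 0`") is NECESSARY for the congruence characterisation, at every `p`.
[cite: Pollack2003, Prop. 6.18 and Lemma 4.7] [cite: MazurTateTeitelbaum1986Invent, §I.10 Prop. (10.2)]
[cite: Kobayashi2003, Conjecture (Main Conjecture) (p. 2)] -/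
theorem not_isPollackPair_of_cuspCoeff_ne_zero (hf0 : IsNewform0 f) (hQ : coeffField f = ⊥)
    (hpN : ¬ p ∣ N) {ap : ℤ} (hap : cuspCoeff f p = ap) (hap0 : ap ≠ 0)
    (Lplus Lminus : IwasawaAlgebra p) : ¬ IsPollackPair f p Lplus Lminus := by
  intro hP
  have hprime : p.Prime := hp.out
  -- the finite zero set of `L⁺` in the open unit disc
  set Z : Set ℂ_[p] := {z : ℂ_[p] | ‖z‖ < 1 ∧
    HasSum (fun k ↦ algebraMap ℚ_[p] ℂ_[p] (PowerSeries.coeff k (iwasawaToPowerSeries p Lplus)) *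
      z ^ k) 0} with hZ
  have hZfin : Z.Finite :=
    MemIwasawaRat.finite_setOf_hasSum_zero (memIwasawaRat_iwasawaToPowerSeries p Lplus)
      (fun h0 ↦ hP.1 (iwasawaToPowerSeries_injective p (by rw [h0, map_zero])))
  have hcoe : ∀ k : ℕ, algebraMap ℚ_[p] ℂ_[p] (PowerSeries.coeff k (iwasawaToPowerSeries p Lplus)) =
      ((algebraMap ℚ_[p] ℂ_[p]).comp (algebraMap ℤ_[p] ℚ_[p])) (PowerSeries.coeff k Lplus) := by
    intro k
    simp only [RingHom.comp_apply, iwasawaToPowerSeries, PowerSeries.coeff_map]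
  -- every odd level `e = 2j + 1` contributes a zero of order-`p^e` type
  have hsub : Set.range (fun j : ℕ ↦ p ^ (2 * j + 1)) ⊆ (fun z : ℂ_[p] ↦ orderOf (1 + z)) '' Z := by
    rintro _ ⟨j, rfl⟩
    obtain ⟨ζ, hζ⟩ := exists_isPrimitiveRoot_padicComplex (p := p) (2 * j)
    have hz : ‖ζ - 1‖ < 1 := norm_sub_one_lt_one_of_pow_prime_pow_eq_one hζ.pow_eq_one
    have h0 := hasSum_pollackPlus_zero_of_cuspCoeff_ne_zero hf0 hQ hpN hap hap0 hP
      (e := 2 * j + 1) ⟨j, rfl⟩ hζ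
    refine ⟨ζ - 1, ⟨hz, ?_⟩, ?_⟩
    · simpa only [hcoe] using h0
    · dsimp only
      rw [add_sub_cancel, ← hζ.eq_orderOf]
  have hinj : Function.Injective (fun j : ℕ ↦ p ^ (2 * j + 1)) := by
    intro j j' h
    have := Nat.pow_right_injective hprime.two_le h
    omega
  exact (Set.infinite_range_of_injective hinj) ((hZfin.image _).subset hsub)

/-- **No Pollack pair for the newform of `E` at a good prime with `a_p(E) ≠ 0`** (`f` a newform of
the globally minimal `W` at level `N_E`, `IsNewformOf W f`; then `f` is rational, `p ∤ N_E` and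
`a_p(f) = a_p(E)`). [cite: Pollack2003, Prop. 6.18] -/
theorem not_isPollackPair_of_frobeniusTrace_ne_zero {W : WeierstrassCurve ℚ} [W.IsElliptic]
    [W.IsGloballyMinimal] (hf : IsNewformOf W f) (hgood : W.HasGoodReductionAtPrime p)
    (ha : W.frobeniusTrace p ≠ 0) (Lplus Lminus : IwasawaAlgebra p) :
    ¬ IsPollackPair f p Lplus Lminus :=
  not_isPollackPair_of_cuspCoeff_ne_zero hf.1 hf.coeffField_eq_bot
    (not_dvd_level_of_isNewformOf hf hgood) (cuspCoeff_eq_frobeniusTrace_of_isNewformOf_holds hf hgood)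
    ha Lplus Lminus

end NoPollackPair

/-! ## §3 The X-kernel's signed leaves are VACUOUS off `a_p = 0` -/

section Vacuous

variable (W : WeierstrassCurve ℚ) [W.IsElliptic] [W.IsGloballyMinimal] (p : ℕ) [hp : Fact p.Prime]

/-- **`KobayashiMainConjecture W p ε` holds VACUOUSLY when `a_p(E) ≠ 0`** (good reduction at `p`):
its binder "`∀ (L⁺, L⁻), IsPollackPair f p L⁺ L⁻ → …`" is empty by
`not_isPollackPair_of_frobeniusTrace_ne_zero`. So on such classes the `@[conjecture]` leaf carries
no content (Kobayashi states it under "Suppose `a_p = 0`").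
[cite: Kobayashi2003, Conjecture (Main Conjecture) (p. 2)] [cite: Pollack2003, Prop. 6.18] -/
theorem kobayashiMainConjecture_of_frobeniusTrace_ne_zero (hgood : W.HasGoodReductionAtPrime p)
    (ha : W.frobeniusTrace p ≠ 0) (ε : ℤˣ) : KobayashiMainConjecture W p ε := by
  intro κ γ _ _ _ _ f hf ϖ _ Lplus Lminus hL D
  exact absurd hL (not_isPollackPair_of_frobeniusTrace_ne_zero hf hgood ha Lplus Lminus)

/-- **`KobayashiLowerDivisibility W p ε` holds VACUOUSLY when `a_p(E) ≠ 0`** (good reduction at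
`p`), for the same reason. [cite: Kobayashi2003, Conjecture (Main Conjecture) (p. 2)] [cite: Pollack2003, Prop. 6.18] -/
theorem kobayashiLowerDivisibility_of_frobeniusTrace_ne_zero (hgood : W.HasGoodReductionAtPrime p)
    (ha : W.frobeniusTrace p ≠ 0) (ε : ℤˣ) : KobayashiLowerDivisibility W p ε :=
  kobayashiLowerDivisibility_of_mainConjecture
    (kobayashiMainConjecture_of_frobeniusTrace_ne_zero W p hgood ha ε)

end Vacuous

/-! ## §4 Readings at `p = 2` for the crux `SupersingularRankZeroAtTwo` -/

section Two

variable {W : WeierstrassCurve ℚ} [W.IsElliptic] [W.IsGloballyMinimal]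
  [NeZero (W.conductorNorm ℤ)] {f : CuspForm (Gamma0 (W.conductorNorm ℤ)) 2}

/-- **In analytic rank `0`, a Pollack pair at `2` exists iff `a₂ = 0`.** For `f` a newform of the
globally minimal `W` with good reduction at `2` and `L(E,1) ≠ 0`: `→` is
`not_isPollackPair_of_frobeniusTrace_ne_zero`, `←` is GEN 0's `exists_isPollackPair_two` (Sprung's
pair at `2` is a Pollack pair when `a₂ = 0`). [cite: Pollack2003, Prop. 6.18] [cite: Sprung2017, §1.1 and Thm. 1.12] -/
theorem exists_isPollackPair_two_iff_frobeniusTrace_eq_zero [Fact (Nat.Prime 2)]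
    (hf : IsNewformOf W f) (hgood : W.HasGoodReductionAtPrime 2) (hL : W.entireLFunction 1 ≠ 0) :
    (∃ Lplus Lminus : IwasawaAlgebra 2, IsPollackPair f 2 Lplus Lminus) ↔ W.frobeniusTrace 2 = 0 := by
  constructor
  · rintro ⟨Lplus, Lminus, hP⟩
    by_contra ha
    exact not_isPollackPair_of_frobeniusTrace_ne_zero hf hgood ha Lplus Lminus hP
  · intro ha
    obtain ⟨Ls, Lf, -, hP⟩ := exists_isPollackPair_two hf hgood ha hL
    exact ⟨Ls, Lf, hP⟩

end Two

section TwoClass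

/-- **The `a₂ = ±2` sub-row of the crux: `SS.KobayashiMainConjecture W 2 ε` is VACUOUS there** —
the ∀-closed class-level statement "for every non-CM `E/ℚ` (globally minimal `W`) of analytic rank
`0` with good supersingular reduction at `2` and `a₂ = ±2`, Kobayashi's main conjecture at `(E, 2, ε)`
holds for both signs" is PROVED, because it is content-free (no Pollack pair at `2` off `a₂ = 0`).
Typed obstruction for line `signed-halves-two` of item 19097: stub (5) (`a₂ = ±2`, 549/757 r0 classes)
cannot be re-typed through the tree's signed leaves. (The hypotheses `¬HasCM`, `analyticRank = 0` are
the crux's binders, displayed and unused.)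
[cite: Kobayashi2003, Conjecture (Main Conjecture) (p. 2)] [cite: Pollack2003, Prop. 6.18] -/
theorem traceTwo_kobayashiMainConjecture_two [Fact (Nat.Prime 2)] :
    ∀ (W : WeierstrassCurve ℚ) [W.IsElliptic] [W.IsGloballyMinimal],
      ¬ W.HasCM → W.analyticRank = 0 → GoodSS W 2 →
        (W.frobeniusTrace 2 = 2 ∨ W.frobeniusTrace 2 = -2) →
          ∀ ε : ℤˣ, KobayashiMainConjecture W 2 ε := by
  intro W _ _ _ _ hss ha ε
  refine kobayashiMainConjecture_of_frobeniusTrace_ne_zero W 2 hss.1 ?_ ε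
  rcases ha with h | h <;> rw [h] <;> decide

/-- **The `a₂ = ±2` sub-row of the crux: `SS.KobayashiLowerDivisibility W 2 ε` is VACUOUS there**
(the Eisenstein-half leaf named in the route text of item 19097 as a "layer-2 object typed"): the
∀-closed class-level statement is PROVED, content-free. Contrast: on `a₂ = 0` the same leaf is the
genuine stub (3) `stub_zeroKobayashiLower` (its Pollack binder is inhabited, `exists_isPollackPair_two`).
[cite: Kobayashi2003, Conjecture (Main Conjecture) (p. 2)] [cite: Pollack2003, Prop. 6.18] -/
theorem traceTwo_kobayashiLowerDivisibility_two [Fact (Nat.Prime 2)] :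
    ∀ (W : WeierstrassCurve ℚ) [W.IsElliptic] [W.IsGloballyMinimal],
      ¬ W.HasCM → W.analyticRank = 0 → GoodSS W 2 →
        (W.frobeniusTrace 2 = 2 ∨ W.frobeniusTrace 2 = -2) →
          ∀ ε : ℤˣ, KobayashiLowerDivisibility W 2 ε := by
  intro W _ _ hcm hr hss ha ε
  exact kobayashiLowerDivisibility_of_mainConjecture
    (traceTwo_kobayashiMainConjecture_two W hcm hr hss ha ε)

end TwoClass

/-! ## §5 (appended, GEN 3) Non-vacuity on `a₂ = 0`: every binder of the signed leaves is inhabited -/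

section NonVacuous

/-- **On `a₂ = 0` the signed leaves at `2` are NOT vacuous: all their universally quantified binders
are simultaneously inhabited.** For a globally minimal `W/ℚ` with good reduction at `2`, `a₂ = 0`
and `L(E,1) ≠ 0`, granted modularity (`hmod`, BCDT: a modular parametrisation datum): there are a
cyclotomic `ℤ₂`-extension `κ` with a topological generator `γ` matching the cyclotomic variable
(tree theorem `exists_isCyclotomic_isTopGenerator_isCyclotomicVariable_holds`), the newform `f` of
`W` with a period ratio `ϖ`, `ϖ·Ω_E = Ω⁺_f` (`ModularParametrizationData.exists_rat_mul_realPeriodRat_eq_plusPeriod`),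
a Pollack pair at `2` (`exists_isPollackPair_two`, Sprung's pair), and for every sign a dual datum of
`Sel^ε(E/ℚ_∞)` (`nonempty_signedSelmerDualData`). Hence `SS.KobayashiMainConjecture W 2 ε` /
`SS.KobayashiLowerDivisibility W 2 ε` — and the line's stubs (3)/(4) — carry GENUINE content on the
`a₂ = 0` sub-row, in contrast with the `a₂ = ±2` sub-row (§3–§4: vacuous).
[cite: Pollack2003, Prop. 6.18] [cite: Sprung2017, §1.1 and Thm. 1.12] [cite: Kobayashi2003, Def. 1.1 and Conjecture (p. 2)] -/
theorem signedLeaves_two_binders_inhabited_of_frobeniusTrace_eq_zero [Fact (Nat.Prime 2)]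
    (hmod : nonempty_modularParametrizationData) (W : WeierstrassCurve ℚ) [W.IsElliptic]
    [W.IsGloballyMinimal] [NeZero (W.conductorNorm ℤ)] (hgood : W.HasGoodReductionAtPrime 2)
    (ha : W.frobeniusTrace 2 = 0) (hL : W.entireLFunction 1 ≠ 0) :
    ∃ (κ : ZpExtension ℚ 2) (γ : Field.absoluteGaloisGroup ℚ),
      κ.IsCyclotomic ∧ κ.IsTopGenerator γ ∧ IsCyclotomicVariable 2 γ ∧
      (∃ (f : CuspForm (Gamma0 (W.conductorNorm ℤ)) 2), IsNewformOf W f ∧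
        (∃ ϖ : ℚ, (ϖ : ℝ) * W.realPeriodRat = plusPeriod f) ∧
        ∃ Lplus Lminus : IwasawaAlgebra 2, IsPollackPair f 2 Lplus Lminus) ∧
      ∀ ε : ℤˣ, Nonempty (Kobayashi2003.SignedSelmerDualData W κ γ ε) := by
  obtain ⟨κ, hκ, γ, hγ, hγ'⟩ := exists_isCyclotomic_isTopGenerator_isCyclotomicVariable_holds 2
  obtain ⟨Dm⟩ := hmod W
  obtain ⟨ϖ, -, hϖ, -⟩ := Dm.exists_rat_mul_realPeriodRat_eq_plusPeriod
  obtain ⟨Ls, Lf, -, hP⟩ := exists_isPollackPair_two Dm.isNewformOf hgood ha hL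
  exact ⟨κ, γ, hκ, hγ, hγ', ⟨Dm.f, Dm.isNewformOf, ⟨ϖ, hϖ⟩, Ls, Lf, hP⟩,
    fun ε ↦ Kobayashi2003.nonempty_signedSelmerDualData W κ ε hγ⟩

end NonVacuous

end Summit.BirchSwinnertonDyer.BirchSwinnertonDyer.Theorems

end
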